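import Mathlib
import Summits.ValiantsHypothesis.ValiantsHypothesis.Theorems.KPlusLogSqLawWeakLiftingTowerGraftFibreRealitySigned

/-!
# Tower graft line — T3 structure: a DEFINITE PENCIL has totally real fibres — no fold wherever some `a·G(t) + b·S` is positive definite

Sequel to `…TowerGraftFibreRealitySigned.lean` (§2 there: the case `a = 1, b = 0`, definite BASE) — same seat, LINE (B)
`Cruxes/WeakLifting/Lines/tower_graft.lean`, crux `WeakLifting` (stmt-ValiantsHypothesis-19561), memo `tower_graft-S5.md` §1 (Ed)/§3 T3.  NO stub is claimed.

THE THEOREM (`card_roots_fibre_eq_card_of_definitePencil`).  `G`, `S` real symmetric, `S` non-singular, and SOME real combination `a·G + b·S` with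
`a ≠ 0` positive definite.  Then the fibre polynomial `det (X·S + G)` has exactly `m` roots counted with multiplicity, ALL REAL: the classical
hyperbolicity of DEFINITE symmetric pencils, here as the affine substitution `T ↦ aT − b` of the prequel's definite-base count
(`a·(T·S + G) = (aT − b)·S + (aG + bS)`, `det_fibre_affine`).  READING FOR T3: a far letter `S` (of any signature) cannot fold over a point `t` at which
the pencil `(G(t), S)` is definite — the fold zone is contained in the NON-DEFINITE zone `{t : no a·G(t) + b·S ≻ 0}`, in general strictly smaller than
the indefinite zone of `G(t)` itself.  (The case `a = 0`, `S` definite, is the hyperbolic pencil and needs no theorem of this line.)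
HONEST FRAMING: structure of the fibres only; no fold count; nothing on S4/S4b/S5, TowerB, `WeakLifting`, Conjecture B, 18050 or VP ≠ VNP.  Def-free;
Mathlib + the prequel.  Seat: prover val-sym-lift-p2 g22, `--supports stmt-ValiantsHypothesis-19561 --as helper`.
-/

-- `Summit.ValiantsHypothesis.ValiantsHypothesis.…` repeats a component by the D-0017 layout
-- (single-conjunct summit), which the `dupNamespace` linter flags; the name is mandated.
set_option linter.dupNamespace false

namespace Summit.ValiantsHypothesis.ValiantsHypothesis.Theorems.KPlusLogSqLaw.TowerGraft

open Polynomial Matrix Finset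
open scoped BigOperators
open Summit.ValiantsHypothesis.ValiantsHypothesis.Theorems.LacunarySymmetroidMatrixDescartes
open Summit.ValiantsHypothesis.ValiantsHypothesis.Theorems.LacunarySymmetroidMatrixDescartes.Inertia

variable {ι : Type} [Fintype ι] [DecidableEq ι]

/-! ## §1 The affine substitution of the fibre polynomial -/

/-- **affine substitution.**  `C(a)^m · det (X·S + G) = (det (X·S + (a·G + b·S))).comp (C a · X + C (−b))`: multiplying the fibre matrix by `a`
turns the base `G` into the combination `aG + bS` at the shifted parameter `aT − b`. [folklore] -/
theorem det_fibre_affine (G S : Matrix ι ι ℝ) (a b : ℝ) :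
    C a ^ Fintype.card ι * ((X : ℝ[X]) • S.map C + G.map C).det =
      (((X : ℝ[X]) • S.map C + (a • G + b • S).map C).det).comp (C a * X + C (-b)) := by
  -- `comp` is a ring hom on the matrix entries
  have hcomp : (((X : ℝ[X]) • S.map C + (a • G + b • S).map C).det).comp (C a * X + C (-b)) =
      (((X : ℝ[X]) • S.map C + (a • G + b • S).map C).map (Polynomial.compRingHom (C a * X + C (-b)))).det := by
    rw [← Polynomial.coe_compRingHom_apply, RingHom.map_det, RingHom.mapMatrix_apply]
  rw [hcomp]
  -- the substituted matrix is `a • (X•S + G)` entrywise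
  have hmat : ((X : ℝ[X]) • S.map C + (a • G + b • S).map C).map (Polynomial.compRingHom (C a * X + C (-b))) =
      C a • ((X : ℝ[X]) • S.map C + G.map C) := by
    refine Matrix.ext fun i j => ?_
    simp only [Matrix.map_apply, Matrix.add_apply, Matrix.smul_apply, smul_eq_mul, Polynomial.coe_compRingHom_apply,
      mul_comp, X_comp, C_comp, map_add, C_mul, map_neg]
    ring
  rw [hmat, det_smul]

/-! ## §2 Definite pencils have totally real fibres -/

/-- **TOTALLY REAL FIBRES OF A DEFINITE PENCIL.**  `G`, `S` real symmetric, `S` non-singular, `a ≠ 0` and `a·G + b·S ≻ 0`.  Then the fibre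
polynomial `det (X·S + G)` — of degree `m` — has `m` roots counted with multiplicity, i.e. ALL ITS ROOTS ARE REAL; no far letter folds over a
point where the pencil `(G(t), S)` is definite. [this work; classical for definite pencils] -/
theorem card_roots_fibre_eq_card_of_definitePencil (G S : Matrix ι ι ℝ) (hG : G.IsSymm) (hS : S.IsSymm) (hSdet : S.det ≠ 0)
    (a b : ℝ) (ha : a ≠ 0) (hdef : (a • G + b • S).PosDef) :
    Multiset.card ((X : ℝ[X]) • S.map C + G.map C).det.roots = Fintype.card ι := by
  classical
  have hMs : (a • G + b • S).IsSymm := (hG.smul a).add (hS.smul b)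
  obtain ⟨hall, -, -⟩ := card_roots_fibre_eq_card_of_posDef (a • G + b • S) S hdef hMs hS hSdet
  -- transport the count along the affine substitution
  set p : ℝ[X] := ((X : ℝ[X]) • S.map C + G.map C).det with hp
  set q : ℝ[X] := ((X : ℝ[X]) • S.map C + (a • G + b • S).map C).det with hq
  have haff := det_fibre_affine G S a b
  have hCa : C a ^ Fintype.card ι ≠ 0 := pow_ne_zero _ (by rwa [Ne, Polynomial.C_eq_zero])
  have hroots : p.roots = (q.comp (C a * X + C (-b))).roots := by
    rw [← haff, ← C_pow, Polynomial.roots_C_mul _ (pow_ne_zero _ ha)]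
  rw [hroots, Polynomial.roots_comp_C_mul_X_add_C q a (-b) (isUnit_iff_ne_zero.mpr ha), Multiset.card_map]
  exact hall

/-- degree bookkeeping: with `m` real roots counted with multiplicity and degree `m`, the real-root deficiency is zero. [this work] -/
theorem natDegree_eq_card_roots_fibre_of_definitePencil (G S : Matrix ι ι ℝ) (hG : G.IsSymm) (hS : S.IsSymm) (hSdet : S.det ≠ 0)
    (a b : ℝ) (ha : a ≠ 0) (hdef : (a • G + b • S).PosDef) :
    ((X : ℝ[X]) • S.map C + G.map C).det.natDegree = Multiset.card ((X : ℝ[X]) • S.map C + G.map C).det.roots := by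
  rw [card_roots_fibre_eq_card_of_definitePencil G S hG hS hSdet a b ha hdef, natDegree_det_fibre G S hSdet]

end Summit.ValiantsHypothesis.ValiantsHypothesis.Theorems.KPlusLogSqLaw.TowerGraft
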